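import Mathlib
import HarnessLib
import Summits.ValiantsHypothesis.ValiantsHypothesis.Theorems.LacunarySymmetroidMatrixDescartesOsculationLawRankOneSheets

/-!
# ValiantsHypothesis / LacunarySymmetroid — crux `MatrixDescartes` (stmt-ValiantsHypothesis-18050, V1),
# line `Cruxes/MatrixDescartes/Lines/osculation_law.lean` («osculation-law»), rung O2 «DIAGONAL + RANK-ONE letters»:
# the TOP-SPLITTING MONIC COROLLARY — `Φ(t,·)` is MONIC of degree `m` in `u`, and a finite osculation set is counted by
# the positive roots of the `u`-RESULTANT `Res_u(Φ, H(Φ))`  (desk RULING #305 (a); spec crit-1 g2 #67 (2) / 17:25Z)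

Class (val-lit-p5 g13's O2 engine ✓ `OsculationSecular.insertionPoly_diagonal_add_rankOne`, p648657): all letters diagonal except
`S l₀ = diagonal a₀ + vecMulVec w w'`, here at the TOP splitting `(r, s) = (m, 0)` (the inserted letter is the identity, every sheet
carries `u = X 1`).  With the bivariate dictionary `toBiv Φ = MvPolynomial.aeval ![C X, X] Φ ∈ ℝ[t][u]` of ✓
`OsculationUniform.eval_map_toBiv` (written INLINE, no definition):

* (S1) `toBiv_monic`: `toBiv Φ` is MONIC of `natDegree = m` in `u` (`∏_k (u + g_k(t))` is monic of degree `m`; the rank-one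
  secular sum `t^(d l₀)·Σ_k ω_k ∏_(k'≠k) (u + g_k'(t))` has `u`-degree `≤ m − 1`).  Hence NO fibre `Φ(t,·)` vanishes and the leading
  coefficient has NO exceptional abscissa (the two provisos of ✓ `OsculationUniform.abscissa_isRoot` are idle on this class).
* (S2′, companion file `…OsculationLawRankOneResultant.lean`) `osc_le_card_pos_roots_resultant`: if `Res_u(toBiv Φ, toBiv H(Φ)) ≢ 0` then the osculation set of the line (vocabulary of
  `osculation_law.lean` UNFOLDED VERBATIM: `insertionPoly`, `logHessian`, `osculationSet`) is FINITE and
  `#osc ≤ m · #{t > 0 : Res_u(Φ, H Φ)(t) = 0}` (von zur Gathen–Gerhard Lemma 6.25 (ii) ✓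
  `Literature…map_resultant_eq_zero_iff_not_isCoprime` with the monic leading coefficient; each fibre has `≤ m` roots).

WHAT IS NOT CLAIMED: the support / degree budget of `Res_u` — the O2 COUNT — stays open (CONJECTURE O2, val-lit-p5 g13's memo
`NOTE-p5g13-18050-O2-rankone-census.md`); the singular points of the curve lie only over the skeleton crossings by p5's interlacing
files (✓ p650908 `…RankOneInterlace`, part 1c), not used here.  HONEST LABEL: a restricted-class ENGINE corollary toward a rung; NOT
`stub_osculationLaw`, not `MatrixDescartes` (stmt-18050), not Conjecture B; `VP ≠ VNP` is NOT proved; no summit statement is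
proved here.  No definitions, no named facts.  Writer val-port-4 g2 (O2 owner val-sym-mdr-p2, engine val-lit-p5 g13; courtesy).
-/

-- `Summit.ValiantsHypothesis.ValiantsHypothesis.…` is the tree's mandated single-conjunct layout (Sub = Summit).
set_option linter.dupNamespace false

noncomputable section

namespace Summit.ValiantsHypothesis.ValiantsHypothesis.Theorems.LacunarySymmetroidMatrixDescartes

namespace OsculationSecular

open Polynomial Matrix
open scoped BigOperators

/-! ### The dictionary on generators -/

/-- `toBiv (C r) = C (C r)`. [folklore] -/
theorem toBiv_C (r : ℝ) :
    MvPolynomial.aeval (![Polynomial.C Polynomial.X, Polynomial.X] : Fin 2 → ℝ[X][X]) (MvPolynomial.C r) = Polynomial.C (Polynomial.C r) := by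
  rw [MvPolynomial.aeval_C, IsScalarTower.algebraMap_apply ℝ ℝ[X] ℝ[X][X], Polynomial.algebraMap_eq,
    Polynomial.algebraMap_eq]

/-- `toBiv (X 0) = C X` (the inner variable `t`). [folklore] -/
theorem toBiv_X_zero :
    MvPolynomial.aeval (![Polynomial.C Polynomial.X, Polynomial.X] : Fin 2 → ℝ[X][X])
      (MvPolynomial.X (0 : Fin 2) : MvPolynomial (Fin 2) ℝ) = Polynomial.C Polynomial.X := by
  rw [MvPolynomial.aeval_X, Matrix.cons_val_zero]

/-- `toBiv (X 1) = X` (the outer variable `u`). [folklore] -/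
theorem toBiv_X_one :
    MvPolynomial.aeval (![Polynomial.C Polynomial.X, Polynomial.X] : Fin 2 → ℝ[X][X])
      (MvPolynomial.X (1 : Fin 2) : MvPolynomial (Fin 2) ℝ) = Polynomial.X := by
  rw [MvPolynomial.aeval_X, Matrix.cons_val_one, Matrix.cons_val_zero]

/-! ### (S1) The top-splitting insertion polynomial of the class is monic of degree `m` in `u` -/

set_option maxHeartbeats 800000 in
/-- **(S1) MONIC.**  At the top splitting `(m, 0)`, for «all letters diagonal except `S l₀ = diagonal a₀ + vecMulVec w w'`», the
`u`-polynomial `toBiv Φ` of the line's insertion polynomial is MONIC with `natDegree = m`. [folklore, over ✓ p648657] -/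
theorem toBiv_monic (m K : ℕ) (d : Fin K → ℕ) (S : Fin K → Matrix (Fin m ⊕ Fin 0) (Fin m ⊕ Fin 0) ℝ)
    (l₀ : Fin K) (a₀ w w' : Fin m ⊕ Fin 0 → ℝ) (hS : ∀ l, l ≠ l₀ → (S l).IsDiag)
    (h₀ : S l₀ = Matrix.diagonal a₀ + Matrix.vecMulVec w w') :
    (MvPolynomial.aeval (![Polynomial.C Polynomial.X, Polynomial.X] : Fin 2 → ℝ[X][X])
        (∑ l, (MvPolynomial.X (0 : Fin 2) : MvPolynomial (Fin 2) ℝ) ^ d l •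
              (S l).map (MvPolynomial.C : ℝ →+* MvPolynomial (Fin 2) ℝ)
            + (MvPolynomial.X (1 : Fin 2) : MvPolynomial (Fin 2) ℝ) •
              (Matrix.fromBlocks 1 0 0 0 : Matrix (Fin m ⊕ Fin 0) (Fin m ⊕ Fin 0) ℝ).map
                (MvPolynomial.C : ℝ →+* MvPolynomial (Fin 2) ℝ)).det).Monic ∧
      (MvPolynomial.aeval (![Polynomial.C Polynomial.X, Polynomial.X] : Fin 2 → ℝ[X][X])
        (∑ l, (MvPolynomial.X (0 : Fin 2) : MvPolynomial (Fin 2) ℝ) ^ d l •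
              (S l).map (MvPolynomial.C : ℝ →+* MvPolynomial (Fin 2) ℝ)
            + (MvPolynomial.X (1 : Fin 2) : MvPolynomial (Fin 2) ℝ) •
              (Matrix.fromBlocks 1 0 0 0 : Matrix (Fin m ⊕ Fin 0) (Fin m ⊕ Fin 0) ℝ).map
                (MvPolynomial.C : ℝ →+* MvPolynomial (Fin 2) ℝ)).det).natDegree = m := by
  classical
  rw [insertionPoly_diagonal_add_rankOne m 0 K d S l₀ a₀ w w' hS h₀]
  have helim : ∀ k : Fin m ⊕ Fin 0, (Sum.elim (fun _ => (1 : MvPolynomial (Fin 2) ℝ)) (fun _ => 0) k) = 1 := by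
    rintro (i | j)
    · rfl
    · exact j.elim0
  -- the skeleton sheets become `X + C g_k`
  have hV : ∀ k : Fin m ⊕ Fin 0,
      MvPolynomial.aeval (![Polynomial.C Polynomial.X, Polynomial.X] : Fin 2 → ℝ[X][X])
          ((∑ l ∈ Finset.univ.erase l₀, (MvPolynomial.X (0 : Fin 2) : MvPolynomial (Fin 2) ℝ) ^ d l *
          MvPolynomial.C (S l k k)) + (MvPolynomial.X (0 : Fin 2) : MvPolynomial (Fin 2) ℝ) ^ d l₀ * MvPolynomial.C (a₀ k) +
          MvPolynomial.X 1 * Sum.elim (fun _ => 1) (fun _ => 0) k) =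
        Polynomial.X + Polynomial.C ((∑ l ∈ Finset.univ.erase l₀, Polynomial.X ^ d l * Polynomial.C (S l k k)) +
          Polynomial.X ^ d l₀ * Polynomial.C (a₀ k)) := by
    intro k
    rw [helim k, mul_one]
    simp only [map_add, map_sum, map_mul, map_pow, toBiv_C, toBiv_X_zero, toBiv_X_one]
    ring
  have hmon1 : ∀ k : Fin m ⊕ Fin 0,
      (MvPolynomial.aeval (![Polynomial.C Polynomial.X, Polynomial.X] : Fin 2 → ℝ[X][X])
          ((∑ l ∈ Finset.univ.erase l₀, (MvPolynomial.X (0 : Fin 2) : MvPolynomial (Fin 2) ℝ) ^ d l *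
          MvPolynomial.C (S l k k)) + (MvPolynomial.X (0 : Fin 2) : MvPolynomial (Fin 2) ℝ) ^ d l₀ * MvPolynomial.C (a₀ k) +
          MvPolynomial.X 1 * Sum.elim (fun _ => 1) (fun _ => 0) k)).Monic ∧
      (MvPolynomial.aeval (![Polynomial.C Polynomial.X, Polynomial.X] : Fin 2 → ℝ[X][X])
          ((∑ l ∈ Finset.univ.erase l₀, (MvPolynomial.X (0 : Fin 2) : MvPolynomial (Fin 2) ℝ) ^ d l *
          MvPolynomial.C (S l k k)) + (MvPolynomial.X (0 : Fin 2) : MvPolynomial (Fin 2) ℝ) ^ d l₀ * MvPolynomial.C (a₀ k) +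
          MvPolynomial.X 1 * Sum.elim (fun _ => 1) (fun _ => 0) k)).natDegree = 1 := by
    intro k
    rw [hV k]
    exact ⟨Polynomial.monic_X_add_C _, Polynomial.natDegree_X_add_C _⟩
  -- the product of the sheets: monic of degree `m`
  have hprod : (∏ k : Fin m ⊕ Fin 0, MvPolynomial.aeval (![Polynomial.C Polynomial.X, Polynomial.X] : Fin 2 → ℝ[X][X])
          ((∑ l ∈ Finset.univ.erase l₀, (MvPolynomial.X (0 : Fin 2) : MvPolynomial (Fin 2) ℝ) ^ d l *
          MvPolynomial.C (S l k k)) + (MvPolynomial.X (0 : Fin 2) : MvPolynomial (Fin 2) ℝ) ^ d l₀ * MvPolynomial.C (a₀ k) +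
          MvPolynomial.X 1 * Sum.elim (fun _ => 1) (fun _ => 0) k)).Monic :=
    Polynomial.monic_prod_of_monic _ _ fun k _ => (hmon1 k).1
  have hprod_deg : (∏ k : Fin m ⊕ Fin 0, MvPolynomial.aeval (![Polynomial.C Polynomial.X, Polynomial.X] : Fin 2 → ℝ[X][X])
          ((∑ l ∈ Finset.univ.erase l₀, (MvPolynomial.X (0 : Fin 2) : MvPolynomial (Fin 2) ℝ) ^ d l *
          MvPolynomial.C (S l k k)) + (MvPolynomial.X (0 : Fin 2) : MvPolynomial (Fin 2) ℝ) ^ d l₀ * MvPolynomial.C (a₀ k) +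
          MvPolynomial.X 1 * Sum.elim (fun _ => 1) (fun _ => 0) k)).natDegree = m := by
    rw [Polynomial.natDegree_prod_of_monic _ _ fun k _ => (hmon1 k).1,
      Finset.sum_congr rfl fun k _ => (hmon1 k).2]
    simp only [Finset.sum_const, Finset.card_univ, Fintype.card_sum, Fintype.card_fin, smul_eq_mul, mul_one, add_zero]
  -- the rank-one tail has `u`-degree `≤ m − 1`
  have htail : ∀ k : Fin m ⊕ Fin 0, (∏ k' ∈ Finset.univ.erase k, MvPolynomial.aeval (![Polynomial.C Polynomial.X, Polynomial.X] : Fin 2 → ℝ[X][X])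
          ((∑ l ∈ Finset.univ.erase l₀, (MvPolynomial.X (0 : Fin 2) : MvPolynomial (Fin 2) ℝ) ^ d l *
            MvPolynomial.C (S l k' k')) + (MvPolynomial.X (0 : Fin 2) : MvPolynomial (Fin 2) ℝ) ^ d l₀ * MvPolynomial.C (a₀ k') +
            MvPolynomial.X 1 * Sum.elim (fun _ => 1) (fun _ => 0) k')).natDegree ≤ m - 1 := by
    intro k
    rw [Polynomial.natDegree_prod_of_monic _ _ fun k' _ => (hmon1 k').1,
      Finset.sum_congr rfl fun k' _ => (hmon1 k').2]
    simp only [Finset.sum_const, smul_eq_mul, mul_one, Finset.card_erase_of_mem (Finset.mem_univ k),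
      Finset.card_univ, Fintype.card_sum, Fintype.card_fin, add_zero, le_refl]
  have hsplit : ∀ (A : MvPolynomial (Fin 2) ℝ) (f : Fin m ⊕ Fin 0 → MvPolynomial (Fin 2) ℝ)
      (g : Fin m ⊕ Fin 0 → Fin m ⊕ Fin 0 → MvPolynomial (Fin 2) ℝ),
      MvPolynomial.aeval (![Polynomial.C Polynomial.X, Polynomial.X] : Fin 2 → ℝ[X][X])
          ((∏ k : Fin m ⊕ Fin 0, f k) + A * ∑ k : Fin m ⊕ Fin 0, MvPolynomial.C (w k * w' k) * ∏ k' ∈ Finset.univ.erase k, g k k') =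
        (∏ k : Fin m ⊕ Fin 0, MvPolynomial.aeval (![Polynomial.C Polynomial.X, Polynomial.X] : Fin 2 → ℝ[X][X]) (f k)) +
          MvPolynomial.aeval (![Polynomial.C Polynomial.X, Polynomial.X] : Fin 2 → ℝ[X][X]) A *
            ∑ k : Fin m ⊕ Fin 0, MvPolynomial.aeval (![Polynomial.C Polynomial.X, Polynomial.X] : Fin 2 → ℝ[X][X]) (MvPolynomial.C (w k * w' k)) *
              ∏ k' ∈ Finset.univ.erase k, MvPolynomial.aeval (![Polynomial.C Polynomial.X, Polynomial.X] : Fin 2 → ℝ[X][X]) (g k k') := by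
    intro A f g
    simp only [map_add, map_prod, map_mul, map_sum]
  have hsplit' := hsplit ((MvPolynomial.X (0 : Fin 2) : MvPolynomial (Fin 2) ℝ) ^ d l₀)
    (fun k => ((∑ l ∈ Finset.univ.erase l₀, (MvPolynomial.X (0 : Fin 2) : MvPolynomial (Fin 2) ℝ) ^ d l *
          MvPolynomial.C (S l k k)) + (MvPolynomial.X (0 : Fin 2) : MvPolynomial (Fin 2) ℝ) ^ d l₀ * MvPolynomial.C (a₀ k) +
          MvPolynomial.X 1 * Sum.elim (fun _ => 1) (fun _ => 0) k))
    (fun k k' => ((∑ l ∈ Finset.univ.erase l₀, (MvPolynomial.X (0 : Fin 2) : MvPolynomial (Fin 2) ℝ) ^ d l *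
            MvPolynomial.C (S l k' k')) + (MvPolynomial.X (0 : Fin 2) : MvPolynomial (Fin 2) ℝ) ^ d l₀ * MvPolynomial.C (a₀ k') +
            MvPolynomial.X 1 * Sum.elim (fun _ => 1) (fun _ => 0) k'))
  rw [hsplit']
  have hT : ((MvPolynomial.aeval (![Polynomial.C Polynomial.X, Polynomial.X] : Fin 2 → ℝ[X][X])) ((MvPolynomial.X (0 : Fin 2) : MvPolynomial (Fin 2) ℝ) ^ d l₀) *
      ∑ k : Fin m ⊕ Fin 0, (MvPolynomial.aeval (![Polynomial.C Polynomial.X, Polynomial.X] : Fin 2 → ℝ[X][X])) (MvPolynomial.C (w k * w' k)) *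
        ∏ k' ∈ Finset.univ.erase k, MvPolynomial.aeval (![Polynomial.C Polynomial.X, Polynomial.X] : Fin 2 → ℝ[X][X])
          ((∑ l ∈ Finset.univ.erase l₀, (MvPolynomial.X (0 : Fin 2) : MvPolynomial (Fin 2) ℝ) ^ d l *
            MvPolynomial.C (S l k' k')) + (MvPolynomial.X (0 : Fin 2) : MvPolynomial (Fin 2) ℝ) ^ d l₀ * MvPolynomial.C (a₀ k') +
            MvPolynomial.X 1 * Sum.elim (fun _ => 1) (fun _ => 0) k')).natDegree ≤ m - 1 := by
    refine (Polynomial.natDegree_mul_le).trans ?_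
    have h0 : ((MvPolynomial.aeval (![Polynomial.C Polynomial.X, Polynomial.X] : Fin 2 → ℝ[X][X])) ((MvPolynomial.X (0 : Fin 2) : MvPolynomial (Fin 2) ℝ) ^ d l₀)).natDegree = 0 := by
      rw [map_pow, toBiv_X_zero, ← Polynomial.C_pow, Polynomial.natDegree_C]
    rw [h0, zero_add]
    refine Polynomial.natDegree_sum_le_of_forall_le _ _ fun k _ => ?_
    refine (Polynomial.natDegree_mul_le).trans ?_
    rw [toBiv_C, Polynomial.natDegree_C, zero_add]
    exact htail k
  rcases Nat.eq_zero_or_pos m with hm | hm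
  · subst hm
    have he : (Finset.univ : Finset (Fin 0 ⊕ Fin 0)) = ∅ := Finset.univ_eq_empty
    simp only [he, Finset.prod_empty, Finset.sum_empty, mul_zero, add_zero]
    exact ⟨Polynomial.monic_one, Polynomial.natDegree_one⟩
  · have hlt : ((MvPolynomial.aeval (![Polynomial.C Polynomial.X, Polynomial.X] : Fin 2 → ℝ[X][X])) ((MvPolynomial.X (0 : Fin 2) : MvPolynomial (Fin 2) ℝ) ^ d l₀) *
        ∑ k : Fin m ⊕ Fin 0, (MvPolynomial.aeval (![Polynomial.C Polynomial.X, Polynomial.X] : Fin 2 → ℝ[X][X])) (MvPolynomial.C (w k * w' k)) *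
          ∏ k' ∈ Finset.univ.erase k, MvPolynomial.aeval (![Polynomial.C Polynomial.X, Polynomial.X] : Fin 2 → ℝ[X][X])
            ((∑ l ∈ Finset.univ.erase l₀, (MvPolynomial.X (0 : Fin 2) : MvPolynomial (Fin 2) ℝ) ^ d l *
              MvPolynomial.C (S l k' k')) + (MvPolynomial.X (0 : Fin 2) : MvPolynomial (Fin 2) ℝ) ^ d l₀ * MvPolynomial.C (a₀ k') +
              MvPolynomial.X 1 * Sum.elim (fun _ => 1) (fun _ => 0) k')).degree <
        (∏ k : Fin m ⊕ Fin 0, MvPolynomial.aeval (![Polynomial.C Polynomial.X, Polynomial.X] : Fin 2 → ℝ[X][X])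
          ((∑ l ∈ Finset.univ.erase l₀, (MvPolynomial.X (0 : Fin 2) : MvPolynomial (Fin 2) ℝ) ^ d l *
          MvPolynomial.C (S l k k)) + (MvPolynomial.X (0 : Fin 2) : MvPolynomial (Fin 2) ℝ) ^ d l₀ * MvPolynomial.C (a₀ k) +
          MvPolynomial.X 1 * Sum.elim (fun _ => 1) (fun _ => 0) k)).degree :=
      Polynomial.degree_lt_degree (by rw [hprod_deg]; omega)
    exact ⟨hprod.add_of_left hlt, by rw [Polynomial.natDegree_add_eq_left_of_degree_lt hlt, hprod_deg]⟩


end OsculationSecular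

end Summit.ValiantsHypothesis.ValiantsHypothesis.Theorems.LacunarySymmetroidMatrixDescartes

end
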